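import Summits.HubbardSuperconductivity.HubbardSuperconductivity.Theorems.AnisotropyChordTransferFibre3RowDLoopSums
import Summits.HubbardSuperconductivity.HubbardSuperconductivity.Theorems.AnisotropyChordTransferFibre3ManifoldA

/-!
# Route `AnisotropyChord` / H0 rotor rung, row D (KT-2a) Stage-1b: the TYPED THREE-SLOT TABLES `bnd3`, `bndM`

Stage-1b of the row-D program (p1 g30), continuation of `…RowDLoopSums`: the norm of a typed three-slot loop numerator
`Σ_p R_ψ₃ R_ψ₁ R_ψ₂` (legs = sum-preserving reparametrisations) is bounded by a TABLE in `a, c_s, S₁, S₂, V, c_Z, g_max`: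
* ★ `slot_regime` — a located ground profile (`L ≥ 128`, `0 ≤ Δ < 1`) has `a ≥ 0`, `c_s ≥ 0`, `0 ≤ ν < 4/π²`, `λ₂ < 2ε₁`;
  ★ `norm_plain/grad/shift` — pointwise slot norms;
* ★ `bnd3` / `bnd3At` / ★ `norm_loop3w_le` — N-type (one plain slot of kind `ku`, two gradient-weighted of kinds `kw, kw′`; 8 cases:
  `SSS c_s³c_Z S₂ · S(SJ) 2a c_s²√(c_Z S₂S₁) · S(JJ) 4a²c_sS₁ · J(SS) a c_s²c_Z S₁ · J(SJ) 2a²c_s√(c_Z S₁V) · JJJ 4a³V`);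
* ★ `bndM` / `bndMAt` / ★ `norm_loop3u_le` — three plain slots (`c_s³g_maxS₂ / a c_s²S₂ / a²c_sS₁ / a³V` by the number of `S` slots).
Prover seat `hubbard-h0-rotor-p1` g30 (route lead); helper for piece A = stmt-HubbardSuperconductivity-23918 of rung 19089
(`--supports`, helper class).  Nothing here proves superconductivity in the Hubbard model; lemmas for ONE row of ONE conditional reduction;
the rotor TARGET as originally worded stays FALSE (g15 verdict).  Tree imports only; no sorry.
-/

set_option linter.dupNamespace false
set_option autoImplicit false

open scoped BigOperators

namespace Summit.HubbardSuperconductivity.HubbardSuperconductivity.Theorems.AnisotropyChord.Transfer.Fibre3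

namespace RowD

open RowC L2.N1

variable (L : ℕ) [NeZero L]

/-! ## The typed three-slot products -/

section three
variable (Δ lam2 : ℝ) (f : Tor L → ℝ)

/-- ★ the slot regime of a located ground profile (`L ≥ 128`, `0 ≤ Δ < 1`): `a = Δf(x̂) ≥ 0`, `c_s ≥ 0`, `0 ≤ ν < 4/π²`, `λ₂ < 2ε₁`. [folklore] -/
theorem slot_regime (hL : 128 ≤ L) (hΔ0 : 0 ≤ Δ) (hΔ1 : Δ < 1) (hf : IsGroundTwoMagnon L Δ lam2 f) :
    0 ≤ Δ * f (K1 L) ∧ 0 ≤ cS L Δ lam2 f ∧ 0 ≤ lam2 / (2 * Real.pi / L) ^ 2 ∧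
      lam2 / (2 * Real.pi / L) ^ 2 < 4 / Real.pi ^ 2 ∧ lam2 < 2 * eps1 L := by
  have hfpos : 0 < f (K1 L) := hf.1.2.2.1
  have hlam : 0 < lam2 := lam2_pos L (by omega) hΔ1 hf.1
  have hLpos : (0 : ℝ) < L := by exact_mod_cast (show 0 < L by omega)
  have ht : 0 < (2 * Real.pi / L : ℝ) ^ 2 := by positivity
  have hνc := ManifoldA.nu_ceiling L hL hΔ0 hf
  refine ⟨by positivity, by unfold cS; positivity, by positivity, ?_, lam2_lt_two_eps1 L (by omega) hΔ0 hf⟩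
  rw [div_lt_iff₀ ht]
  have hπ2 : Real.pi ^ 2 < 10 := by nlinarith [Real.pi_lt_d2, Real.pi_pos]
  have h4 : (0.031 : ℝ) < 4 / Real.pi ^ 2 := by rw [lt_div_iff₀ (by positivity)]; nlinarith
  nlinarith

/-- ★ THE N-TYPE TABLE: bound of `Σ_p ‖R_u‖‖R_w‖‖R_w′‖` for one plain slot (kind `ku`) and two gradient-weighted slots (kinds `kw, kw′`),
in terms of `a, c_s, S₁, S₂, V, c_Z`. -/
noncomputable def bnd3 (a cs S1 S2 V cz : ℝ) (ku kw kw' : Bool) : ℝ :=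
  match ku, kw, kw' with
  | true, true, true => cs ^ 3 * (cz * S2)
  | true, true, false => cs ^ 2 * (2 * a) * Real.sqrt (cz * S2 * S1)
  | true, false, true => cs ^ 2 * (2 * a) * Real.sqrt (cz * S2 * S1)
  | true, false, false => cs * (2 * a) ^ 2 * S1
  | false, true, true => a * cs ^ 2 * (cz * S1)
  | false, true, false => a * cs * (2 * a) * Real.sqrt (cz * S1 * V)
  | false, false, true => a * cs * (2 * a) * Real.sqrt (cz * S1 * V)
  | false, false, false => a * (2 * a) ^ 2 * V

/-- the table at the profile's data. -/
noncomputable def bnd3At (ku kw kw' : Bool) : ℝ :=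
  bnd3 (Δ * f (K1 L)) (cS L Δ lam2 f) (S1n L lam2) (S2n L lam2) ((L : ℝ) ^ 2) (cZ (lam2 / (2 * Real.pi / L) ^ 2)) ku kw kw'

/-- pointwise norm of a plain typed factor. [folklore] -/
theorem norm_plain (hL : 128 ≤ L) (hΔ0 : 0 ≤ Δ) (hΔ1 : Δ < 1) (hf : IsGroundTwoMagnon L Δ lam2 f) (k : Bool) (e q : Tor L) :
    ‖RfacU L lam2 (psiU L Δ lam2 f k 1 0 e) q‖ = if k then cS L Δ lam2 f * gres L lam2 q else Δ * f (K1 L) := by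
  obtain ⟨ha0, hcs0, -, hν, -⟩ := slot_regime L Δ lam2 f hL hΔ0 hΔ1 hf
  cases k
  · rw [norm_rfacU_J L Δ lam2 f ha0, wfac_plain, one_mul]; rfl
  · rw [norm_rfacU_S L Δ lam2 f hcs0 _ _ _ _ (g_nonneg L hν q), wfac_plain, one_mul]; rfl

/-- pointwise norm of a gradient-weighted typed factor. [folklore] -/
theorem norm_grad (hL : 128 ≤ L) (hΔ0 : 0 ≤ Δ) (hΔ1 : Δ < 1) (hf : IsGroundTwoMagnon L Δ lam2 f) (k : Bool) (e q : Tor L) :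
    ‖RfacU L lam2 (psiU L Δ lam2 f k 1 (-1) e) q‖
      = wnorm L q e * (if k then cS L Δ lam2 f * gres L lam2 q else Δ * f (K1 L)) := by
  obtain ⟨ha0, hcs0, -, hν, -⟩ := slot_regime L Δ lam2 f hL hΔ0 hΔ1 hf
  cases k
  · rw [norm_rfacU_J L Δ lam2 f ha0, wfac_grad]; rfl
  · rw [norm_rfacU_S L Δ lam2 f hcs0 _ _ _ _ (g_nonneg L hν q), wfac_grad]; rfl

/-- pointwise norm of a shifted typed factor. [folklore] -/
theorem norm_shift (hL : 128 ≤ L) (hΔ0 : 0 ≤ Δ) (hΔ1 : Δ < 1) (hf : IsGroundTwoMagnon L Δ lam2 f) (k : Bool) (e q : Tor L) :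
    ‖RfacU L lam2 (psiU L Δ lam2 f k 0 1 e) q‖ = if k then cS L Δ lam2 f * gres L lam2 q else Δ * f (K1 L) := by
  obtain ⟨ha0, hcs0, -, hν, -⟩ := slot_regime L Δ lam2 f hL hΔ0 hΔ1 hf
  cases k
  · rw [norm_rfacU_J L Δ lam2 f ha0, wfac_shift, one_mul]; rfl
  · rw [norm_rfacU_S L Δ lam2 f hcs0 _ _ _ _ (g_nonneg L hν q), wfac_shift, one_mul]; rfl

/-- the gradient weight of a `J` slot is at most `2`. [folklore] -/
theorem wnorm_le_two (q e : Tor L) : wnorm L q e ≤ 2 := norm_wt_le_two L q e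

/-- ★ THE N-TYPE PRODUCT BOUND: `‖Σ_p R_u(affine L σu cu p) R_w(affine L σw cw p) R_w′(ℓw′ p)‖ ≤ bnd3 ku kw kw′` (legs sum-preserving, weight vectors in `E4`). [folklore] -/
theorem norm_loop3w_le (hL : 128 ≤ L) (hΔ0 : 0 ≤ Δ) (hΔ1 : Δ < 1) (hf : IsGroundTwoMagnon L Δ lam2 f) (ku kw kw' : Bool) (eu : Tor L) {ew ew' : ℤ × ℤ}
    (hew : ew ∈ E4) (hew' : ew' ∈ E4) (σu : Bool) (cu : Tor L) (σw : Bool) (cw : Tor L) (σw' : Bool) (cw' : Tor L) :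
    ‖∑ p : Tor L, RfacU L lam2 (psiU L Δ lam2 f ku 1 0 eu) (affine L σu cu p)
        * RfacU L lam2 (psiU L Δ lam2 f kw 1 (-1) (B1.toTor L ew)) (affine L σw cw p)
        * RfacU L lam2 (psiU L Δ lam2 f kw' 1 (-1) (B1.toTor L ew')) (affine L σw' cw' p)‖
      ≤ bnd3At L Δ lam2 f ku kw kw' := by
  obtain ⟨ha0', hcs0', hν0, hν, _⟩ := slot_regime L Δ lam2 f hL hΔ0 hΔ1 hf
  set a := Δ * f (K1 L) with ha
  set cs := cS L Δ lam2 f with hcs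
  set g := gres L lam2 with hg
  have ha0 : 0 ≤ a := ha0'
  have hcs0 : 0 ≤ cs := hcs0'
  have hg0 : ∀ q, 0 ≤ g q := fun q => g_nonneg L hν q
  have hw0 : ∀ q e, 0 ≤ wnorm L q e := fun q e => wnorm_nonneg L q e
  have hw2 : ∀ q e, wnorm L q e ≤ 2 := fun q e => wnorm_le_two L q e
  -- step 1: triangle inequality with the pointwise norms
  refine (norm_sum_le _ _).trans ?_
  simp only [norm_mul, norm_plain L Δ lam2 f hL hΔ0 hΔ1 hf, norm_grad L Δ lam2 f hL hΔ0 hΔ1 hf]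
  -- step 2: the eight cases
  unfold bnd3At bnd3
  cases ku <;> cases kw <;> cases kw' <;>
    simp only [Bool.false_eq_true, if_false, if_true, ← ha, ← hcs, ← hg]
  · -- J J J : a · (w a) · (w a) ≤ a (2a)² V
    calc ∑ p, a * (wnorm L (affine L σw cw p) (B1.toTor L ew) * a) * (wnorm L (affine L σw' cw' p) (B1.toTor L ew') * a)
        ≤ ∑ _p : Tor L, a * (2 * a) * (2 * a) := Finset.sum_le_sum fun p _ => by
          have h1 := hw2 (affine L σw cw p) (B1.toTor L ew); have h2 := hw2 (affine L σw' cw' p) (B1.toTor L ew')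
          have h1' := hw0 (affine L σw cw p) (B1.toTor L ew); have h2' := hw0 (affine L σw' cw' p) (B1.toTor L ew')
          have := mul_le_mul h1 h2 h2' (by norm_num)
          nlinarith [mul_nonneg ha0 (mul_nonneg ha0 ha0)]
      _ = a * (2 * a) ^ 2 * (L : ℝ) ^ 2 := by
          rw [Finset.sum_const, Finset.card_univ, Fintype.card_prod, ZMod.card, nsmul_eq_mul]; push_cast; ring
  · -- J J S : a · (w a) · (w cs g) ≤ a cs (2a) √(cz S1 V)
    have hf := fam_w L hν0 hν σw' cw' hew'
    calc ∑ p, a * (wnorm L (affine L σw cw p) (B1.toTor L ew) * a) * (wnorm L (affine L σw' cw' p) (B1.toTor L ew') * (cs * g (affine L σw' cw' p)))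
        ≤ ∑ p, a * (2 * a) * cs * (wnorm L (affine L σw' cw' p) (B1.toTor L ew') * g (affine L σw' cw' p)) := Finset.sum_le_sum fun p _ => by
          have h1 := hw2 (affine L σw cw p) (B1.toTor L ew)
          have hx : 0 ≤ wnorm L (affine L σw' cw' p) (B1.toTor L ew') * g (affine L σw' cw' p) := mul_nonneg (hw0 _ _) (hg0 _)
          have : a * (wnorm L (affine L σw cw p) (B1.toTor L ew) * a) ≤ a * (2 * a) := by
            nlinarith [mul_nonneg (mul_nonneg ha0 ha0) (sub_nonneg.2 h1)]
          calc a * (wnorm L (affine L σw cw p) (B1.toTor L ew) * a) * (wnorm L (affine L σw' cw' p) (B1.toTor L ew') * (cs * g (affine L σw' cw' p)))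
              = (a * (wnorm L (affine L σw cw p) (B1.toTor L ew) * a)) * cs * (wnorm L (affine L σw' cw' p) (B1.toTor L ew') * g (affine L σw' cw' p)) := by ring
            _ ≤ (a * (2 * a)) * cs * (wnorm L (affine L σw' cw' p) (B1.toTor L ew') * g (affine L σw' cw' p)) := by gcongr
      _ = a * (2 * a) * cs * ∑ p, wnorm L (affine L σw' cw' p) (B1.toTor L ew') * g (affine L σw' cw' p) := by rw [Finset.mul_sum]
      _ ≤ a * (2 * a) * cs * Real.sqrt (cZ (lam2 / (2 * Real.pi / L) ^ 2) * S1n L lam2 * (L : ℝ) ^ 2) := by gcongr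
      _ = a * cs * (2 * a) * Real.sqrt (cZ (lam2 / (2 * Real.pi / L) ^ 2) * S1n L lam2 * (L : ℝ) ^ 2) := by ring
  · -- J S J
    have hf := fam_w L hν0 hν σw cw hew
    calc ∑ p, a * (wnorm L (affine L σw cw p) (B1.toTor L ew) * (cs * g (affine L σw cw p))) * (wnorm L (affine L σw' cw' p) (B1.toTor L ew') * a)
        ≤ ∑ p, a * (2 * a) * cs * (wnorm L (affine L σw cw p) (B1.toTor L ew) * g (affine L σw cw p)) := Finset.sum_le_sum fun p _ => by
          have h2 := hw2 (affine L σw' cw' p) (B1.toTor L ew')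
          have hx : 0 ≤ wnorm L (affine L σw cw p) (B1.toTor L ew) * g (affine L σw cw p) := mul_nonneg (hw0 _ _) (hg0 _)
          have : a * (wnorm L (affine L σw' cw' p) (B1.toTor L ew') * a) ≤ a * (2 * a) := by
            nlinarith [mul_nonneg (mul_nonneg ha0 ha0) (sub_nonneg.2 h2)]
          calc a * (wnorm L (affine L σw cw p) (B1.toTor L ew) * (cs * g (affine L σw cw p))) * (wnorm L (affine L σw' cw' p) (B1.toTor L ew') * a)
              = (a * (wnorm L (affine L σw' cw' p) (B1.toTor L ew') * a)) * cs * (wnorm L (affine L σw cw p) (B1.toTor L ew) * g (affine L σw cw p)) := by ring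
            _ ≤ (a * (2 * a)) * cs * (wnorm L (affine L σw cw p) (B1.toTor L ew) * g (affine L σw cw p)) := by gcongr
      _ = a * (2 * a) * cs * ∑ p, wnorm L (affine L σw cw p) (B1.toTor L ew) * g (affine L σw cw p) := by rw [Finset.mul_sum]
      _ ≤ a * (2 * a) * cs * Real.sqrt (cZ (lam2 / (2 * Real.pi / L) ^ 2) * S1n L lam2 * (L : ℝ) ^ 2) := by gcongr
      _ = a * cs * (2 * a) * Real.sqrt (cZ (lam2 / (2 * Real.pi / L) ^ 2) * S1n L lam2 * (L : ℝ) ^ 2) := by ring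
  · -- J S S : a (w cs g)(w cs g) ≤ a cs² cz S1
    have hf := fam_ww L hν0 hν σw cw σw' cw' hew hew'
    calc ∑ p, a * (wnorm L (affine L σw cw p) (B1.toTor L ew) * (cs * g (affine L σw cw p))) * (wnorm L (affine L σw' cw' p) (B1.toTor L ew') * (cs * g (affine L σw' cw' p)))
        = a * cs ^ 2 * ∑ p, (wnorm L (affine L σw cw p) (B1.toTor L ew) * g (affine L σw cw p)) * (wnorm L (affine L σw' cw' p) (B1.toTor L ew') * g (affine L σw' cw' p)) := by
          rw [Finset.mul_sum]; exact Finset.sum_congr rfl fun p _ => by ring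
      _ ≤ a * cs ^ 2 * (cZ (lam2 / (2 * Real.pi / L) ^ 2) * S1n L lam2) := by gcongr
  · -- S J J : cs g · (w a)(w a) ≤ cs (2a)² S1
    have hf := fam_g L σu cu lam2
    calc ∑ p, cs * g (affine L σu cu p) * (wnorm L (affine L σw cw p) (B1.toTor L ew) * a) * (wnorm L (affine L σw' cw' p) (B1.toTor L ew') * a)
        ≤ ∑ p, cs * (2 * a) ^ 2 * g (affine L σu cu p) := Finset.sum_le_sum fun p _ => by
          have h1 := hw2 (affine L σw cw p) (B1.toTor L ew); have h2 := hw2 (affine L σw' cw' p) (B1.toTor L ew')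
          have h1' := hw0 (affine L σw cw p) (B1.toTor L ew); have h2' := hw0 (affine L σw' cw' p) (B1.toTor L ew')
          have hww : wnorm L (affine L σw cw p) (B1.toTor L ew) * wnorm L (affine L σw' cw' p) (B1.toTor L ew') ≤ 2 * 2 := mul_le_mul h1 h2 h2' (by norm_num)
          have hx : 0 ≤ cs * g (affine L σu cu p) * (a * a) := by have := hg0 (affine L σu cu p); positivity
          calc cs * g (affine L σu cu p) * (wnorm L (affine L σw cw p) (B1.toTor L ew) * a) * (wnorm L (affine L σw' cw' p) (B1.toTor L ew') * a)
              = cs * g (affine L σu cu p) * (a * a) * (wnorm L (affine L σw cw p) (B1.toTor L ew) * wnorm L (affine L σw' cw' p) (B1.toTor L ew')) := by ring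
            _ ≤ cs * g (affine L σu cu p) * (a * a) * (2 * 2) := mul_le_mul_of_nonneg_left hww hx
            _ = cs * (2 * a) ^ 2 * g (affine L σu cu p) := by ring
      _ = cs * (2 * a) ^ 2 * S1n L lam2 := by rw [← Finset.mul_sum, hf]
  · -- S J S : cs g · (w a) · (w cs g) ≤ cs² (2a) √(cz S2 S1)
    have hf := fam_gw L hν0 hν σu cu σw' cw' hew'
    calc ∑ p, cs * g (affine L σu cu p) * (wnorm L (affine L σw cw p) (B1.toTor L ew) * a) * (wnorm L (affine L σw' cw' p) (B1.toTor L ew') * (cs * g (affine L σw' cw' p)))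
        ≤ ∑ p, cs ^ 2 * (2 * a) * (g (affine L σu cu p) * (wnorm L (affine L σw' cw' p) (B1.toTor L ew') * g (affine L σw' cw' p))) := Finset.sum_le_sum fun p _ => by
          have h1 := hw2 (affine L σw cw p) (B1.toTor L ew); have h1' := hw0 (affine L σw cw p) (B1.toTor L ew)
          have hx : 0 ≤ cs ^ 2 * a * (g (affine L σu cu p) * (wnorm L (affine L σw' cw' p) (B1.toTor L ew') * g (affine L σw' cw' p))) := by
            have := hg0 (affine L σu cu p); have := hg0 (affine L σw' cw' p); have := hw0 (affine L σw' cw' p) (B1.toTor L ew'); positivity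
          calc cs * g (affine L σu cu p) * (wnorm L (affine L σw cw p) (B1.toTor L ew) * a) * (wnorm L (affine L σw' cw' p) (B1.toTor L ew') * (cs * g (affine L σw' cw' p)))
              = cs ^ 2 * a * (g (affine L σu cu p) * (wnorm L (affine L σw' cw' p) (B1.toTor L ew') * g (affine L σw' cw' p))) * wnorm L (affine L σw cw p) (B1.toTor L ew) := by ring
            _ ≤ cs ^ 2 * a * (g (affine L σu cu p) * (wnorm L (affine L σw' cw' p) (B1.toTor L ew') * g (affine L σw' cw' p))) * 2 := mul_le_mul_of_nonneg_left h1 hx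
            _ = cs ^ 2 * (2 * a) * (g (affine L σu cu p) * (wnorm L (affine L σw' cw' p) (B1.toTor L ew') * g (affine L σw' cw' p))) := by ring
      _ = cs ^ 2 * (2 * a) * ∑ p, g (affine L σu cu p) * (wnorm L (affine L σw' cw' p) (B1.toTor L ew') * g (affine L σw' cw' p)) := by rw [Finset.mul_sum]
      _ ≤ cs ^ 2 * (2 * a) * Real.sqrt (cZ (lam2 / (2 * Real.pi / L) ^ 2) * S2n L lam2 * S1n L lam2) := by gcongr
  · -- S S J
    have hf := fam_gw L hν0 hν σu cu σw cw hew
    calc ∑ p, cs * g (affine L σu cu p) * (wnorm L (affine L σw cw p) (B1.toTor L ew) * (cs * g (affine L σw cw p))) * (wnorm L (affine L σw' cw' p) (B1.toTor L ew') * a)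
        ≤ ∑ p, cs ^ 2 * (2 * a) * (g (affine L σu cu p) * (wnorm L (affine L σw cw p) (B1.toTor L ew) * g (affine L σw cw p))) := Finset.sum_le_sum fun p _ => by
          have h2 := hw2 (affine L σw' cw' p) (B1.toTor L ew'); have h2' := hw0 (affine L σw' cw' p) (B1.toTor L ew')
          have hx : 0 ≤ cs ^ 2 * a * (g (affine L σu cu p) * (wnorm L (affine L σw cw p) (B1.toTor L ew) * g (affine L σw cw p))) := by
            have := hg0 (affine L σu cu p); have := hg0 (affine L σw cw p); have := hw0 (affine L σw cw p) (B1.toTor L ew); positivity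
          calc cs * g (affine L σu cu p) * (wnorm L (affine L σw cw p) (B1.toTor L ew) * (cs * g (affine L σw cw p))) * (wnorm L (affine L σw' cw' p) (B1.toTor L ew') * a)
              = cs ^ 2 * a * (g (affine L σu cu p) * (wnorm L (affine L σw cw p) (B1.toTor L ew) * g (affine L σw cw p))) * wnorm L (affine L σw' cw' p) (B1.toTor L ew') := by ring
            _ ≤ cs ^ 2 * a * (g (affine L σu cu p) * (wnorm L (affine L σw cw p) (B1.toTor L ew) * g (affine L σw cw p))) * 2 := mul_le_mul_of_nonneg_left h2 hx
            _ = cs ^ 2 * (2 * a) * (g (affine L σu cu p) * (wnorm L (affine L σw cw p) (B1.toTor L ew) * g (affine L σw cw p))) := by ring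
      _ = cs ^ 2 * (2 * a) * ∑ p, g (affine L σu cu p) * (wnorm L (affine L σw cw p) (B1.toTor L ew) * g (affine L σw cw p)) := by rw [Finset.mul_sum]
      _ ≤ cs ^ 2 * (2 * a) * Real.sqrt (cZ (lam2 / (2 * Real.pi / L) ^ 2) * S2n L lam2 * S1n L lam2) := by gcongr
  · -- S S S : cs g (w cs g)(w cs g) ≤ cs³ cz S2
    have hf := fam_gww L hν0 hν σu cu σw cw σw' cw' hew hew'
    calc ∑ p, cs * g (affine L σu cu p) * (wnorm L (affine L σw cw p) (B1.toTor L ew) * (cs * g (affine L σw cw p))) * (wnorm L (affine L σw' cw' p) (B1.toTor L ew') * (cs * g (affine L σw' cw' p)))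
        = cs ^ 3 * ∑ p, g (affine L σu cu p) * (wnorm L (affine L σw cw p) (B1.toTor L ew) * g (affine L σw cw p)) * (wnorm L (affine L σw' cw' p) (B1.toTor L ew') * g (affine L σw' cw' p)) := by
          rw [Finset.mul_sum]; exact Finset.sum_congr rfl fun p _ => by ring
      _ ≤ cs ^ 3 * (cZ (lam2 / (2 * Real.pi / L) ^ 2) * S2n L lam2) := by gcongr

/-- ★ THE M-TYPE TABLE (three plain slots): `c_s³ g_max S₂ / a c_s² S₂ / a² c_s S₁ / a³ V` by the number of `S` slots. -/
noncomputable def bndM (a cs S1 S2 V gmax : ℝ) (k3 k1 k2 : Bool) : ℝ :=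
  match k3, k1, k2 with
  | true, true, true => cs ^ 3 * (gmax * S2)
  | true, true, false => a * cs ^ 2 * S2
  | true, false, true => a * cs ^ 2 * S2
  | false, true, true => a * cs ^ 2 * S2
  | true, false, false => a ^ 2 * cs * S1
  | false, true, false => a ^ 2 * cs * S1
  | false, false, true => a ^ 2 * cs * S1
  | false, false, false => a ^ 3 * V

/-- the table at the profile's data. -/
noncomputable def bndMAt (k3 k1 k2 : Bool) : ℝ :=
  bndM (Δ * f (K1 L)) (cS L Δ lam2 f) (S1n L lam2) (S2n L lam2) ((L : ℝ) ^ 2) (1 / (2 * eps1 L - lam2)) k3 k1 k2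

/-- ★ THE M-TYPE PRODUCT BOUND: `‖Σ_p R⁰₃(ℓ₃p) R⁰₁(ℓ₁p) R⁰₂(ℓ₂p)‖ ≤ bndM k3 k1 k2`. [folklore] -/
theorem norm_loop3u_le (hL : 128 ≤ L) (hΔ0 : 0 ≤ Δ) (hΔ1 : Δ < 1) (hf : IsGroundTwoMagnon L Δ lam2 f) (k3 k1 k2 : Bool) (e3 e1 e2 : Tor L)
    (σ3 : Bool) (c3 : Tor L) (σ1 : Bool) (c1 : Tor L) (σ2 : Bool) (c2 : Tor L) :
    ‖∑ p : Tor L, RfacU L lam2 (psiU L Δ lam2 f k3 1 0 e3) (affine L σ3 c3 p) * RfacU L lam2 (psiU L Δ lam2 f k1 1 0 e1) (affine L σ1 c1 p)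
        * RfacU L lam2 (psiU L Δ lam2 f k2 1 0 e2) (affine L σ2 c2 p)‖
      ≤ bndMAt L Δ lam2 f k3 k1 k2 := by
  obtain ⟨ha0', hcs0', _, hν, hlt⟩ := slot_regime L Δ lam2 f hL hΔ0 hΔ1 hf
  set a := Δ * f (K1 L) with ha
  set cs := cS L Δ lam2 f with hcs
  set g := gres L lam2 with hg
  have ha0 : 0 ≤ a := ha0'
  have hcs0 : 0 ≤ cs := hcs0'
  have hg0 : ∀ q, 0 ≤ g q := fun q => g_nonneg L hν q
  refine (norm_sum_le _ _).trans ?_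
  simp only [norm_mul, norm_plain L Δ lam2 f hL hΔ0 hΔ1 hf]
  unfold bndMAt bndM
  cases k3 <;> cases k1 <;> cases k2 <;>
    simp only [Bool.false_eq_true, if_false, if_true, ← ha, ← hcs, ← hg]
  · -- J J J
    rw [Finset.sum_const, Finset.card_univ, Fintype.card_prod, ZMod.card, nsmul_eq_mul]; push_cast
    nlinarith [mul_nonneg ha0 (mul_nonneg ha0 ha0)]
  · -- J J S
    calc ∑ p, a * a * (cs * g (affine L σ2 c2 p)) = a ^ 2 * cs * ∑ p, g (affine L σ2 c2 p) := by
          rw [Finset.mul_sum]; exact Finset.sum_congr rfl fun p _ => by ring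
      _ = a ^ 2 * cs * S1n L lam2 := by rw [fam_g L σ2 c2]
      _ ≤ a ^ 2 * cs * S1n L lam2 := le_rfl
  · -- J S J
    calc ∑ p, a * (cs * g (affine L σ1 c1 p)) * a = a ^ 2 * cs * ∑ p, g (affine L σ1 c1 p) := by
          rw [Finset.mul_sum]; exact Finset.sum_congr rfl fun p _ => by ring
      _ = a ^ 2 * cs * S1n L lam2 := by rw [fam_g L σ1 c1]
      _ ≤ a ^ 2 * cs * S1n L lam2 := le_rfl
  · -- J S S
    calc ∑ p, a * (cs * g (affine L σ1 c1 p)) * (cs * g (affine L σ2 c2 p)) = a * cs ^ 2 * ∑ p, g (affine L σ1 c1 p) * g (affine L σ2 c2 p) := by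
          rw [Finset.mul_sum]; exact Finset.sum_congr rfl fun p _ => by ring
      _ ≤ a * cs ^ 2 * S2n L lam2 := by have := fam_gg L σ1 c1 σ2 c2 lam2; gcongr
  · -- S J J
    calc ∑ p, cs * g (affine L σ3 c3 p) * a * a = a ^ 2 * cs * ∑ p, g (affine L σ3 c3 p) := by
          rw [Finset.mul_sum]; exact Finset.sum_congr rfl fun p _ => by ring
      _ = a ^ 2 * cs * S1n L lam2 := by rw [fam_g L σ3 c3]
      _ ≤ a ^ 2 * cs * S1n L lam2 := le_rfl
  · -- S J S
    calc ∑ p, cs * g (affine L σ3 c3 p) * a * (cs * g (affine L σ2 c2 p)) = a * cs ^ 2 * ∑ p, g (affine L σ3 c3 p) * g (affine L σ2 c2 p) := by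
          rw [Finset.mul_sum]; exact Finset.sum_congr rfl fun p _ => by ring
      _ ≤ a * cs ^ 2 * S2n L lam2 := by have := fam_gg L σ3 c3 σ2 c2 lam2; gcongr
  · -- S S J
    calc ∑ p, cs * g (affine L σ3 c3 p) * (cs * g (affine L σ1 c1 p)) * a = a * cs ^ 2 * ∑ p, g (affine L σ3 c3 p) * g (affine L σ1 c1 p) := by
          rw [Finset.mul_sum]; exact Finset.sum_congr rfl fun p _ => by ring
      _ ≤ a * cs ^ 2 * S2n L lam2 := by have := fam_gg L σ3 c3 σ1 c1 lam2; gcongr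
  · -- S S S
    calc ∑ p, cs * g (affine L σ3 c3 p) * (cs * g (affine L σ1 c1 p)) * (cs * g (affine L σ2 c2 p)) = cs ^ 3 * ∑ p, g (affine L σ3 c3 p) * g (affine L σ1 c1 p) * g (affine L σ2 c2 p) := by
          rw [Finset.mul_sum]; exact Finset.sum_congr rfl fun p _ => by ring
      _ ≤ cs ^ 3 * (1 / (2 * eps1 L - lam2) * S2n L lam2) := by
          have := fam_ggg L (by omega) hν hlt σ3 c3 σ1 c1 σ2 c2; gcongr

end three

end RowD

end Summit.HubbardSuperconductivity.HubbardSuperconductivity.Theorems.AnisotropyChord.Transfer.Fibre3
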